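import Literature.MathematicalPhysics.QuantumLattice.ClusterProductSlice
import HarnessLib

/-!
# Cross-Gram matrices of two-cluster slices: hops on different bonds are orthogonal

Topic `MathematicalPhysics/QuantumLattice`; continues `ClusterProductSlice.lean`.
For the Koszul product states `⊗_c ψ_c` over an ordered cluster partition `P` and the two-cluster slices
`slice_{c₁c₂}(ψ)` (`ClusterProduct.Partition.sliceMap`), the Gram matrix ACROSS two slices,
`(slice_{c₁'c₂'} ψ')ᴴ (slice_{c₁c₂} ψ)`, has entries `Π_c ⟨factor'_c, factor_c⟩` (products of one-cluster
overlaps, `conjTranspose_sliceMap_mul_sliceMap_apply`). Consequently, if some cluster `c₀` of the bra pair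
`{c₁', c₂'}` is NOT in the ket pair `{c₁, c₂}`, the ket factor there is the environment vector `ψ c₀`; when it
is EVEN (fermion parity `0`) it is orthogonal to every odd basis vector, so the rows of the cross-Gram matrix
at odd–odd basis pairs vanish (`conjTranspose_sliceMap_mul_sliceMap_apply_eq_zero`) and
`⟨slice_{c₁'c₂'}(ψ') v', slice_{c₁c₂}(ψ) v⟩ = 0` for every `v'` supported on odd–odd pairs and every `v`
(`star_sliceMap_mulVec_dotProduct_sliceMap_mulVec_eq_zero`).

This is the "different bonds do not talk at second order" step of the plaquette expansion: a one-electron hop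
across a bond makes both of its plaquette factors odd, and two hops on different bonds leave an odd factor facing
an even one (Tsai–Kivelson 2006, App. A; Yao–Tsai–Kivelson 2007, eq. (2): `H_eff` is a sum over bonds).

References: W.-F. Tsai, S. A. Kivelson, PRB 73 (2006) 214510, App. A (A1) [TsaiKivelson2006];
O. Bratteli, D. W. Robinson, *Operator Algebras and QSM II* (1997) §5.2.2 [BratteliRobinsonII1997].
-/

noncomputable section

namespace Literature.MathematicalPhysics.QuantumLattice

open Matrix Finset TwoCluster

namespace ClusterProduct.Partition

variable {ι' C κ : Type*} [LinearOrder ι'] [LinearOrder C] [LinearOrder κ] (P : Partition ι' C κ)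
  [Fintype ι'] [Fintype C] [Fintype κ]

/-- **Entries of the cross-Gram matrix of two slices** are products of one-cluster overlaps:
`((slice_{c₁'c₂'} ψ')ᴴ (slice_{c₁c₂} ψ))_{p'p} = Π_c ⟨f'_c, f_c⟩` with `f' = ψ'[c₁' ↦ |p'.1⟩, c₂' ↦ |p'.2⟩]`,
`f = ψ[c₁ ↦ |p.1⟩, c₂ ↦ |p.2⟩]`. [cite: TsaiKivelson2006, App. A (A1)] -/
theorem conjTranspose_sliceMap_mul_sliceMap_apply (ψ' ψ : C → Fock κ) (c₁' c₂' c₁ c₂ : C)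
    (p' p : Finset κ × Finset κ) :
    ((P.sliceMap ψ' c₁' c₂')ᴴ * P.sliceMap ψ c₁ c₂) p' p =
      ∏ c, star (Function.update (Function.update ψ' c₁' (Pi.single p'.1 1)) c₂' (Pi.single p'.2 1) c) ⬝ᵥ
        Function.update (Function.update ψ c₁ (Pi.single p.1 1)) c₂ (Pi.single p.2 1) c := by
  rw [← P.star_prodFamily_dotProduct_prodFamily, Matrix.mul_apply]
  rfl

/-- **Odd bra factor against an even environment factor**: if a cluster `c₀` of the bra pair `{c₁', c₂'}`
(`c₁' ≠ c₂'`) is not in the ket pair `{c₁, c₂}`, the ket environment vector `ψ c₀` is even, and the bra basis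
pair `p'` is odd–odd, then the cross-Gram entry `(p', p)` vanishes for every `p`. [folklore] -/
theorem conjTranspose_sliceMap_mul_sliceMap_apply_eq_zero {c₁' c₂' c₁ c₂ c₀ : C} (h' : c₁' ≠ c₂')
    (hc₀ : c₀ = c₁' ∨ c₀ = c₂') (h₁ : c₀ ≠ c₁) (h₂ : c₀ ≠ c₂) (ψ' : C → Fock κ) {ψ : C → Fock κ}
    (hψ : HasParity 0 (ψ c₀)) {p' : Finset κ × Finset κ} (hp'₁ : p'.1.card % 2 = 1)
    (hp'₂ : p'.2.card % 2 = 1) (p : Finset κ × Finset κ) :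
    ((P.sliceMap ψ' c₁' c₂')ᴴ * P.sliceMap ψ c₁ c₂) p' p = 0 := by
  rw [P.conjTranspose_sliceMap_mul_sliceMap_apply]
  apply Finset.prod_eq_zero (Finset.mem_univ c₀)
  rw [Function.update_of_ne h₂, Function.update_of_ne h₁]
  -- the bra factor at `c₀` is a basis vector of odd cardinality
  obtain ⟨w, hw, hw'⟩ : ∃ w : Finset κ, w.card % 2 = 1 ∧
      Function.update (Function.update ψ' c₁' (Pi.single p'.1 1)) c₂' (Pi.single p'.2 1) c₀ =
        Pi.single w 1 := by
    rcases hc₀ with rfl | rfl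
    · exact ⟨p'.1, hp'₁, by rw [Function.update_of_ne h', Function.update_self]⟩
    · exact ⟨p'.2, hp'₂, by rw [Function.update_self]⟩
  rw [hw', ← Pi.single_star, star_one, single_dotProduct, one_mul]
  by_contra hne
  have := hψ w hne
  omega

/-- **Hops on different bonds are orthogonal.** If a cluster `c₀` of the bra pair is not in the ket pair,
the ket environment factor `ψ c₀` is even and the bra coordinates `v'` are supported on odd–odd basis pairs,
then `⟨slice_{c₁'c₂'}(ψ') v', slice_{c₁c₂}(ψ) v⟩ = 0` for every `v`.
[cite: TsaiKivelson2006, App. A (A1)] -/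
theorem star_sliceMap_mulVec_dotProduct_sliceMap_mulVec_eq_zero {c₁' c₂' c₁ c₂ c₀ : C} (h' : c₁' ≠ c₂')
    (hc₀ : c₀ = c₁' ∨ c₀ = c₂') (h₁ : c₀ ≠ c₁) (h₂ : c₀ ≠ c₂) (ψ' : C → Fock κ) {ψ : C → Fock κ}
    (hψ : HasParity 0 (ψ c₀)) {v' : Finset κ × Finset κ → ℂ}
    (hv' : ∀ p, v' p ≠ 0 → p.1.card % 2 = 1 ∧ p.2.card % 2 = 1) (v : Finset κ × Finset κ → ℂ) :
    star (P.sliceMap ψ' c₁' c₂' *ᵥ v') ⬝ᵥ (P.sliceMap ψ c₁ c₂ *ᵥ v) = 0 := by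
  rw [star_mulVec, ← dotProduct_mulVec, mulVec_mulVec, dotProduct, Finset.sum_eq_zero]
  intro p' _
  by_cases hp' : v' p' = 0
  · rw [Pi.star_apply, hp', star_zero, zero_mul]
  · rw [mulVec, dotProduct, Finset.sum_eq_zero, mul_zero]
    intro p _
    rw [P.conjTranspose_sliceMap_mul_sliceMap_apply_eq_zero h' hc₀ h₁ h₂ ψ' hψ (hv' p' hp').1 (hv' p' hp').2,
      zero_mul]

end ClusterProduct.Partition

/-- The product vector of two odd vectors is supported on odd–odd basis pairs (the support hypothesis of
`star_sliceMap_mulVec_dotProduct_sliceMap_mulVec_eq_zero` for hop vectors). [folklore] -/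
theorem TwoCluster.HasParity.tensorVec_ne_zero_imp {κ : Type*} {a b : Fock κ} (ha : HasParity 1 a)
    (hb : HasParity 1 b) (p : Finset κ × Finset κ) (hp : tensorVec a b p ≠ 0) :
    p.1.card % 2 = 1 ∧ p.2.card % 2 = 1 := by
  rw [tensorVec_apply] at hp
  exact ⟨ha p.1 (left_ne_zero_of_mul hp), hb p.2 (right_ne_zero_of_mul hp)⟩

end Literature.MathematicalPhysics.QuantumLattice

end
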